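import Literature.Analysis.FluidPDE.TaoAveraged
import HarnessLib

/-!
# Critical Lyapunov functionals for an averaged Navier–Stokes equation `∂ₜu = Δu + B(u,u)`

Problem `NavierStokesRegularity`, route `MonotoneCritical`, definition request
`Literature.NS.CriticalLyapunovFor` (crux #4, the *barrier* companion of the route). The route posits a
**critical Lyapunov functional** for 3-D Navier–Stokes: a functional `M` on velocity fields that is
finite on the data, (almost) non-increasing — more precisely, a-priori bounded in terms of its
initial value — along every solution, and *coercive*: it controls the critical norm `‖·‖_{L³(ℝ³)}`
whose boundedness along a Navier–Stokes solution is known to prevent blow-up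
(Escauriaza–Seregin–Šverák 2003; Seregin 2012). This file writes the **same interface for the
averaged equations of Tao** (T. Tao, *Finite time blowup for an averaged three-dimensional
Navier–Stokes equation*, J. Amer. Math. Soc. 29 (2016), arXiv:1402.0290): the bilinear operator
`B : (ℝ³ → ℝ³) → (ℝ³ → ℝ³) → ℝ³ → ℝ³` is a parameter, "datum" means a Schwartz divergence-free
field (accepted `Fluid.IsSchwartzField`, `Fluid.IsDivFree`; the data class of Tao's Thm. 1.5,
arXiv p. 9), and "solution on `[0,T)`" means an `H¹⁰_df` mild solution of
`u(t) = e^{tΔ}u₀ + ∫₀ᵗ e^{(t-s)Δ} B(u(s),u(s)) ds` on the time set `Ico 0 T` (Tao (1.15), arXiv p. 8;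
`IsH10MildSolutionOn` below, the restriction to `[0,T)` of the accepted global notion
`Literature.Analysis.FluidPDE.IsGlobalH10MildSolution`).

**Nothing about existence is asserted.** `CriticalLyapunovFor B` is a hypothesis *structure*
(a `Type`); the route's barrier item is the statement that for Tao's averaged operator `B̃` with
cancellation (accepted fact `Literature.Analysis.FluidPDE.tao_averaged_ns_blowup`) the type is empty, documenting which
axiom a genuine Navier–Stokes instance must obtain from NS-specific structure rather than from the
energy identity, scaling and multiplier bounds shared by all `B̃` (Tao 2016, discussion after
Thm. 1.5, arXiv p. 9).

## Fields

* `M : (ℝ³ → ℝ³) → ℝ≥0∞` — the functional (value `⊤` allowed on bad fields);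
* `F : ℝ≥0∞ → ℝ → ℝ≥0∞` — the a-priori bound `M (u t) ≤ F (M u₀) t`, finite for finite first
  argument (`F_lt_top`) and non-decreasing in `t` (`F_mono`);
* `G : ℝ≥0∞ → ℝ≥0∞` — the coercivity modulus, finite on finite arguments (`G_lt_top`) and
  monotone (`G_mono`);
* `finite` — `M v < ⊤` for Schwartz divergence-free `v`;
* `almostMonotone` — along every `H¹⁰_df` mild solution on `[0,T)` from a Schwartz divergence-free
  datum, `M (u t) ≤ F (M u₀) t` for all `t ∈ [0,T)`;
* `coercive` — **unconditionally** `‖v‖_{L³} ≤ G (M v)` for every field `v`.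

## Design and junk analysis (the reviewable content of a route-posited object)

* *Coercivity is unconditional* (review of the sibling interface `CriticalLyapunov`, p2880): if it
  were required only on Schwartz/rapidly-decaying fields it could never be applied to `u t` for
  `t > 0` (mild solutions leave the Schwartz class), and `M v := ‖v‖₃` on Schwartz fields, `0`
  elsewhere, would be a junk inhabitant. With the unconditional form, `M v = ⊤` is harmless on bad
  `v` (`G_lt_top` only constrains finite arguments) and the junk instance is excluded (it would
  need `G 0 = ⊤`).
* *Monotonicity of `F m` and `G`* are normalisations (replace a bound by its running supremum);
  they make the a-priori bound **uniform on `[0,T)`**: `‖u t‖₃ ≤ G (F (M u₀) T) < ⊤` for all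
  `t < T` (`eLpNorm_three_le_of_solution`), which is the form a blow-up alternative at a finite
  maximal time `T` consumes. Without them `sup_{t<T} F m t` could be infinite although each value
  is finite.
* *Trivial candidates fail*: `M := 0` violates `coercive ∧ G_lt_top` (`‖·‖₃` is unbounded on
  Schwartz divergence-free fields); `M := ⊤` violates `finite`; `F := ⊤` / `G := ⊤` violate
  `F_lt_top` / `G_lt_top`; `M := ‖·‖₃, F m t := m, G := id` reduces to the a-priori estimate
  `‖u t‖₃ ≤ ‖u₀‖₃` along all solutions, which is exactly the kind of content intended. Conversely
  `CriticalLyapunovFor.ofLThreeBound` shows that *any* a-priori bound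
  `‖u t‖₃ ≤ Φ (‖u₀‖₃) t` (finite, monotone) yields an inhabitant: `Nonempty (CriticalLyapunovFor B)`
  is equivalent in content to a uniform-in-time a-priori `L³` bound for `B`-mild solutions from
  Schwartz divergence-free data.
* *No scaling axiom.* "Critical" refers to the controlled norm (`L³(ℝ³)` is invariant under
  `u ↦ λ u(λ·)`); the interface does not impose scale-invariance of `M` itself.
* *Time `t = 0`.* The mild identity at `t = 0` reads `u 0 = u₀` (accepted
  `Fluid.isAveragedNSMildSolutionOn_zero_iff`), so `F (M u₀) t` and `F (M (u 0)) t` agree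
  (`IsH10MildSolutionOn.initial`); only times in `Ico 0 T` enter `almostMonotone`, so junk values
  of `u` outside `[0,T)` are irrelevant.

## Mathlib / tree search

Mathlib has `MeasureTheory.eLpNorm`, `SchwartzMap.memLp`; nothing on Navier–Stokes or Lyapunov
functionals for PDE (searched `Lyapunov`, `NavierStokes`, `CriticalLyapunov`). Solution classes are
the accepted `Fluid.MemH10DivFree`, `Fluid.IsAveragedNSMildSolutionOn`, `Literature.Analysis.FluidPDE.ContinuousInH10On`,
`Literature.Analysis.FluidPDE.IsGlobalH10MildSolution` (`Literature/Analysis/FluidPDE/TaoAveraged*.lean`).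

## References

* T. Tao, *Finite time blowup for an averaged three-dimensional Navier–Stokes equation*, J. Amer.
  Math. Soc. 29 (2016), 601–674; arXiv:1402.0290v3: mild solutions (1.15) p. 8, Thm. 1.5 p. 9,
  footnote 11 p. 10 (the blow-up is of type II: critical norms diverge).
* L. Escauriaza, G. Seregin, V. Šverák, *`L_{3,∞}`-solutions of Navier–Stokes equations and
  backward uniqueness*, Russian Math. Surveys 58 (2003), Thm. 1.4 (the `L³` criterion motivating
  `coercive`).
-/

noncomputable section

open MeasureTheory Set Filter Topology
open scoped ENNReal

namespace Literature.NS

/-- Local notation for physical space `ℝ³ = EuclideanSpace ℝ (Fin 3)`. -/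
local notation "ℝ³" => EuclideanSpace ℝ (Fin 3)

/-! ## Local-in-time `H¹⁰_df` mild solutions on `[0,T)` -/

/-- **`H¹⁰_df` mild solution on `[0,T)`** of the averaged Navier–Stokes equation
`∂ₜu = Δu + B(u,u)`, `u(0) = u₀` (Tao 2016, (1.15) with `I = [0,T)`): `u t ∈ H¹⁰_df` for
`t ∈ [0,T)`, `u ∈ C([0,T); H¹⁰)`, and the Duhamel identity on `Ico 0 T` (accepted
`Fluid.IsAveragedNSMildSolutionOn`). The restriction to `[0,T)` of the accepted
`IsGlobalH10MildSolution` (`IsGlobalH10MildSolution.isH10MildSolutionOn`).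
[cite: Tao2016, (1.15) (arXiv p. 8), Def. of mild solution on I ⊂ [0,∞)] -/
def IsH10MildSolutionOn (B : (ℝ³ → ℝ³) → (ℝ³ → ℝ³) → ℝ³ → ℝ³) (T : ℝ) (u₀ : ℝ³ → ℝ³)
    (u : ℝ → ℝ³ → ℝ³) : Prop :=
  (∀ t ∈ Ico 0 T, Literature.Analysis.FluidPDE.MemH10DivFree (u t)) ∧ Literature.Analysis.FluidPDE.ContinuousInH10On (Ico 0 T) u ∧
    Literature.Analysis.FluidPDE.IsAveragedNSMildSolutionOn (Ico 0 T) B u₀ u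

namespace IsH10MildSolutionOn

variable {B : (ℝ³ → ℝ³) → (ℝ³ → ℝ³) → ℝ³ → ℝ³} {T T' : ℝ} {u₀ : ℝ³ → ℝ³} {u : ℝ → ℝ³ → ℝ³}

/-- A mild solution on `[0,T)`, `T > 0`, attains its datum: `u 0 = u₀`. [folklore] -/
theorem initial (h : IsH10MildSolutionOn B T u₀ u) (hT : 0 < T) : u 0 = u₀ :=
  (Literature.Analysis.FluidPDE.isAveragedNSMildSolutionOn_zero_iff B u₀ u).1
    (h.2.2.mono (singleton_subset_iff.2 ⟨le_rfl, hT⟩))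

/-- In particular the datum lies in `H¹⁰_df`. [folklore] -/
theorem memH10DivFree_initial (h : IsH10MildSolutionOn B T u₀ u) (hT : 0 < T) :
    Literature.Analysis.FluidPDE.MemH10DivFree u₀ :=
  h.initial hT ▸ h.1 0 ⟨le_rfl, hT⟩

/-- Restriction to a shorter time interval. [folklore] -/
theorem mono (h : IsH10MildSolutionOn B T u₀ u) (hT' : T' ≤ T) : IsH10MildSolutionOn B T' u₀ u :=
  ⟨fun t ht => h.1 t (Ico_subset_Ico_right hT' ht), h.2.1.mono (Ico_subset_Ico_right hT'),
    h.2.2.mono (Ico_subset_Ico_right hT')⟩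

end IsH10MildSolutionOn

/-- A global `H¹⁰_df` mild solution is a mild solution on every `[0,T)`. [folklore] -/
theorem _root_.Literature.Analysis.FluidPDE.IsGlobalH10MildSolution.isH10MildSolutionOn {B : (ℝ³ → ℝ³) → (ℝ³ → ℝ³) → ℝ³ → ℝ³}
    {u₀ : ℝ³ → ℝ³} {u : ℝ → ℝ³ → ℝ³} (h : Literature.Analysis.FluidPDE.IsGlobalH10MildSolution B u₀ u) (T : ℝ) :
    IsH10MildSolutionOn B T u₀ u :=
  ⟨fun t ht => h.1 t ht.1, h.2.1.mono Ico_subset_Ici_self, h.2.2.mono Ico_subset_Ici_self⟩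

/-! ## The interface -/

/-- **Critical Lyapunov functional for the averaged Navier–Stokes equation driven by `B`**
(route `MonotoneCritical`, barrier crux; a *hypothesis structure*, NOT known — and for Tao's `B̃`
expected NOT — to be inhabited). Data `M, F, G` and axioms: `F m t`, `G m` finite for finite `m`
and monotone; `M` finite on Schwartz divergence-free fields; along every `H¹⁰_df` mild solution of
`∂ₜu = Δu + B(u,u)` on `[0,T)` from a Schwartz divergence-free datum, `M (u t) ≤ F (M u₀) t`;
and unconditionally `‖v‖_{L³(ℝ³)} ≤ G (M v)`. See the module docstring for the junk analysis.
[folklore] -/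
structure CriticalLyapunovFor (B : (ℝ³ → ℝ³) → (ℝ³ → ℝ³) → ℝ³ → ℝ³) where
  /-- The functional. -/
  M : (ℝ³ → ℝ³) → ℝ≥0∞
  /-- The a-priori bound along solutions, as a function of `M u₀` and time. -/
  F : ℝ≥0∞ → ℝ → ℝ≥0∞
  /-- The coercivity modulus. -/
  G : ℝ≥0∞ → ℝ≥0∞
  /-- `F` is finite on finite first arguments. -/
  F_lt_top : ∀ ⦃m : ℝ≥0∞⦄, m < ⊤ → ∀ t : ℝ, F m t < ⊤
  /-- `F m` is non-decreasing in time (normalisation: running supremum). -/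
  F_mono : ∀ m : ℝ≥0∞, Monotone (F m)
  /-- `G` is finite on finite arguments. -/
  G_lt_top : ∀ ⦃m : ℝ≥0∞⦄, m < ⊤ → G m < ⊤
  /-- `G` is non-decreasing (normalisation: running supremum). -/
  G_mono : Monotone G
  /-- `M` is finite on Schwartz divergence-free fields (the data class of Tao's Thm. 1.5). -/
  finite : ∀ v : ℝ³ → ℝ³, Literature.Analysis.FluidPDE.IsSchwartzField v → Literature.Analysis.FluidPDE.VectorCalculus.IsDivFree v → M v < ⊤
  /-- Almost-monotonicity: along every `H¹⁰_df` mild solution on `[0,T)` from a Schwartz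
  divergence-free datum, `M (u t) ≤ F (M u₀) t` for `t ∈ [0,T)`. -/
  almostMonotone : ∀ ⦃T : ℝ⦄ ⦃u₀ : ℝ³ → ℝ³⦄ ⦃u : ℝ → ℝ³ → ℝ³⦄, 0 < T →
      Literature.Analysis.FluidPDE.IsSchwartzField u₀ → Literature.Analysis.FluidPDE.VectorCalculus.IsDivFree u₀ → IsH10MildSolutionOn B T u₀ u →
      ∀ t ∈ Ico 0 T, M (u t) ≤ F (M u₀) t
  /-- Coercivity, unconditional: `‖v‖_{L³(ℝ³)} ≤ G (M v)` for every field `v`. -/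
  coercive : ∀ v : ℝ³ → ℝ³, eLpNorm v 3 (volume : Measure ℝ³) ≤ G (M v)

namespace CriticalLyapunovFor

variable {B : (ℝ³ → ℝ³) → (ℝ³ → ℝ³) → ℝ³ → ℝ³} {T : ℝ} {u₀ : ℝ³ → ℝ³} {u : ℝ → ℝ³ → ℝ³}

/-- `‖v‖₃ < ⊤` for Schwartz divergence-free `v`, from `finite`, `coercive`, `G_lt_top`. [folklore] -/
theorem eLpNorm_three_lt_top (Λ : CriticalLyapunovFor B) {v : ℝ³ → ℝ³} (hv : Literature.Analysis.FluidPDE.IsSchwartzField v)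
    (hdiv : Literature.Analysis.FluidPDE.VectorCalculus.IsDivFree v) : eLpNorm v 3 (volume : Measure ℝ³) < ⊤ :=
  (Λ.coercive v).trans_lt (Λ.G_lt_top (Λ.finite v hv hdiv))

/-- Along a solution on `[0,T)` from a Schwartz divergence-free datum, `M (u t) ≤ F (M u₀) T`
uniformly in `t ∈ [0,T)` (`almostMonotone` + `F_mono`). [folklore] -/
theorem M_le_of_solution (Λ : CriticalLyapunovFor B) (hT : 0 < T) (hu₀ : Literature.Analysis.FluidPDE.IsSchwartzField u₀) (hdiv : Literature.Analysis.FluidPDE.VectorCalculus.IsDivFree u₀)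
    (hu : IsH10MildSolutionOn B T u₀ u) {t : ℝ} (ht : t ∈ Ico 0 T) :
    Λ.M (u t) ≤ Λ.F (Λ.M u₀) T :=
  (Λ.almostMonotone hT hu₀ hdiv hu t ht).trans (Λ.F_mono _ ht.2.le)

/-- Along a solution on `[0,T)` from a Schwartz divergence-free datum, `M (u t) < ⊤`. [folklore] -/
theorem M_lt_top_of_solution (Λ : CriticalLyapunovFor B) (hT : 0 < T) (hu₀ : Literature.Analysis.FluidPDE.IsSchwartzField u₀)
    (hdiv : Literature.Analysis.FluidPDE.VectorCalculus.IsDivFree u₀) (hu : IsH10MildSolutionOn B T u₀ u) {t : ℝ} (ht : t ∈ Ico 0 T) :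
    Λ.M (u t) < ⊤ :=
  (Λ.almostMonotone hT hu₀ hdiv hu t ht).trans_lt (Λ.F_lt_top (Λ.finite u₀ hu₀ hdiv) t)

/-- **The uniform a-priori critical bound an inhabitant delivers**: along every `H¹⁰_df` mild
solution on `[0,T)` from a Schwartz divergence-free datum, `‖u t‖_{L³} ≤ G (F (M u₀) T)` for all
`t ∈ [0,T)`, and the right-hand side is finite (`bound_lt_top`). [folklore] -/
theorem eLpNorm_three_le_of_solution (Λ : CriticalLyapunovFor B) (hT : 0 < T) (hu₀ : Literature.Analysis.FluidPDE.IsSchwartzField u₀)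
    (hdiv : Literature.Analysis.FluidPDE.VectorCalculus.IsDivFree u₀) (hu : IsH10MildSolutionOn B T u₀ u) {t : ℝ} (ht : t ∈ Ico 0 T) :
    eLpNorm (u t) 3 (volume : Measure ℝ³) ≤ Λ.G (Λ.F (Λ.M u₀) T) :=
  (Λ.coercive (u t)).trans (Λ.G_mono (Λ.M_le_of_solution hT hu₀ hdiv hu ht))

/-- The uniform bound `G (F (M u₀) T)` is finite for a Schwartz divergence-free datum. [folklore] -/
theorem bound_lt_top (Λ : CriticalLyapunovFor B) (hu₀ : Literature.Analysis.FluidPDE.IsSchwartzField u₀) (hdiv : Literature.Analysis.FluidPDE.VectorCalculus.IsDivFree u₀) (T : ℝ) :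
    Λ.G (Λ.F (Λ.M u₀) T) < ⊤ :=
  Λ.G_lt_top (Λ.F_lt_top (Λ.finite u₀ hu₀ hdiv) T)

/-- Hence `sup_{t ∈ [0,T)} ‖u t‖_{L³} < ⊤` along every solution on `[0,T)` from a Schwartz
divergence-free datum. [folklore] -/
theorem iSup_eLpNorm_three_lt_top (Λ : CriticalLyapunovFor B) (hT : 0 < T) (hu₀ : Literature.Analysis.FluidPDE.IsSchwartzField u₀)
    (hdiv : Literature.Analysis.FluidPDE.VectorCalculus.IsDivFree u₀) (hu : IsH10MildSolutionOn B T u₀ u) :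
    ⨆ t ∈ Ico 0 T, eLpNorm (u t) 3 (volume : Measure ℝ³) < ⊤ :=
  (iSup₂_le fun t (ht : t ∈ Ico 0 T) => Λ.eLpNorm_three_le_of_solution hT hu₀ hdiv hu ht).trans_lt
    (Λ.bound_lt_top hu₀ hdiv T)

/-- **Converse direction of the junk analysis**: any a-priori bound `‖u t‖₃ ≤ Φ (‖u₀‖₃) t` along
`B`-mild solutions from Schwartz divergence-free data, with `Φ` finite on finite arguments and
non-decreasing in `t`, yields an inhabitant (`M := ‖·‖₃`, `F := Φ`, `G := id`). So
`Nonempty (CriticalLyapunovFor B)` carries exactly the content of such an a-priori `L³` bound.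
[folklore] -/
def ofLThreeBound (Φ : ℝ≥0∞ → ℝ → ℝ≥0∞) (hΦ : ∀ ⦃m : ℝ≥0∞⦄, m < ⊤ → ∀ t, Φ m t < ⊤)
    (hΦm : ∀ m, Monotone (Φ m))
    (hB : ∀ ⦃T : ℝ⦄ ⦃u₀ : ℝ³ → ℝ³⦄ ⦃u : ℝ → ℝ³ → ℝ³⦄, 0 < T →
      Literature.Analysis.FluidPDE.IsSchwartzField u₀ → Literature.Analysis.FluidPDE.VectorCalculus.IsDivFree u₀ → IsH10MildSolutionOn B T u₀ u →
      ∀ t ∈ Ico 0 T, eLpNorm (u t) 3 (volume : Measure ℝ³) ≤ Φ (eLpNorm u₀ 3 volume) t) :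
    CriticalLyapunovFor B where
  M v := eLpNorm v 3 volume
  F := Φ
  G := id
  F_lt_top := hΦ
  F_mono := hΦm
  G_lt_top _ hm := hm
  G_mono := monotone_id
  finite v hv _ := by
    obtain ⟨f, rfl⟩ := hv
    exact (f.memLp 3 (volume : Measure ℝ³)).eLpNorm_lt_top
  almostMonotone := hB
  coercive _ := le_rfl

/-- The functional of `ofLThreeBound` is `‖·‖_{L³}`. [folklore] -/
@[simp] theorem ofLThreeBound_M (Φ : ℝ≥0∞ → ℝ → ℝ≥0∞) (hΦ hΦm hB) (v : ℝ³ → ℝ³) :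
    (ofLThreeBound (B := B) Φ hΦ hΦm hB).M v = eLpNorm v 3 volume := rfl

end CriticalLyapunovFor

end Literature.NS
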